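import Summits.NavierStokesRegularity.NavierStokesRegularity.Theorems.ExtremiserTransienceMemberSelectionDefs
import Literature.Analysis.Calculus.SmoothArzelaAscoli
import Literature.Analysis.FluidPDE.KNSSRegularityGalilean
import Literature.Analysis.FluidPDE.TaoEnstrophyLocalisation
import Literature.Analysis.ODE.LiouvilleFormula
import HarnessLib

/-!
# LINE g7-δ «member selection», T1 tool: THE LIMIT STEP — translate-compactness with EXACT passage of the budgets

Crux `NearExtremalTransiencePerFlow` (stmt-NavierStokesRegularity-26567), line δ `member_selection`, stub T1
`stub_coherentSelection` («nested selection, a diagonal sequence and `C^∞_loc` compactness give a limit profile»;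
critic idea-crit-4 N1: «the limit step needs EXACTNESS: `J, Z, P` restricted to the fixed bounded sets `D_k` pass to
the `C^∞_loc` limit with EQUALITY»).  This file proves that step once and for all, for ANY choice of centres:

* `exists_translate_limit` — for `v n : E → F` smooth with UNIFORM bounds `‖Dᵏ v n‖ ≤ Λ k` (all `k, n, x`) and any
  centres `y n`, a subsequence of the translates `z ↦ v (φ n) (y (φ n) + z)` converges with all derivatives,
  uniformly on compact sets, to a smooth `W₀` with the same bounds; in particular pointwise (the convergence clause
  of `CoherentSelection`), and the height bound `‖W₀‖ ≤ M` passes to the limit;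
* `tendsto_fderiv_of_tendstoUniformlyOn`, `tendsto_fderiv_fderiv_of_tendstoUniformlyOn` — pointwise convergence of
  `D`, `D²` from the `C¹`, `C²` clauses; `isDivFree_of_tendsto_fderiv` — `div W₀ = 0` passes to the limit;
  `tendsto_curl_of_tendsto_fderiv`, `tendsto_fderiv_curl_of_tendsto` — so do `curl` and `D curl`, pointwise;
* `tendsto_setIntegral_of_bounded_tendsto` — dominated convergence on a bounded measurable set with a uniform
  constant bound; whence the EXACTNESS statements `tendsto_setIntegral_enstrophy`,
  `tendsto_setIntegral_palinstrophy`, `tendsto_setIntegral_stretching` for `∫_D ‖curl‖²`, `∫_D |D curl|²_F`,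
  `∫_D ⟪curl, D· curl⟫` along the subsequence;
* `exists_limit_of_nearExtremalFamily` — everything packaged for the texts of record `NearExtremalFamily v Λ Θ ε`.

Engine: the tree's `C^∞` Arzelà–Ascoli theorem `Literature.Analysis.Calculus.
exists_strictMono_contDiffOn_infty_tendstoUniformlyOn_iteratedFDeriv` (Petersen 2006, Ch. 10 §3.1).  Pure analysis;
nothing here is a statement about Navier–Stokes.  26567, T1, T3, NS regularity OPEN.  No summit is proved by a line.
-/

noncomputable section

open scoped Topology InnerProductSpace RealInnerProductSpace ENNReal ContDiff
open MeasureTheory Filter Set Metric Function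
open Literature.Analysis.FluidPDE
open Literature.Analysis.Calculus

namespace Summit.NavierStokesRegularity.NavierStokesRegularity.Theorems.NearExtremalTransiencePerFlow.MemberSelection

set_option linter.dupNamespace false

/-! ### Generic calculus: pointwise convergence of `D` and `D²` from the `C¹`, `C²` clauses -/

section Calculus

variable {E : Type*} [NormedAddCommGroup E] [NormedSpace ℝ E]
  {F : Type*} [NormedAddCommGroup F] [NormedSpace ℝ F]

/-- `‖Df(x)‖ = ‖D¹f(x)‖`. [folklore] -/
theorem norm_fderiv_eq_norm_iteratedFDeriv_one (f : E → F) (x : E) :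
    ‖fderiv ℝ f x‖ = ‖iteratedFDeriv ℝ 1 f x‖ := by
  rw [← norm_iteratedFDeriv_fderiv, norm_iteratedFDeriv_zero]

/-- Pointwise convergence of a sequence of functions from uniform convergence of the `0`-th derivatives on
the singleton. [folklore] -/
theorem tendsto_of_tendstoUniformlyOn_zero {G : ℕ → E → F} {g : E → F} {x : E}
    (h : TendstoUniformlyOn (fun n => iteratedFDeriv ℝ 0 (G n)) (iteratedFDeriv ℝ 0 g) atTop {x}) :
    Tendsto (fun n => G n x) atTop (𝓝 (g x)) :=
  tendsto_of_tendstoUniformlyOn_iteratedFDeriv_zero h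

/-- Pointwise convergence of the FIRST derivatives (as continuous linear maps) from uniform convergence of the
first iterated derivatives on the singleton. [folklore] -/
theorem tendsto_fderiv_of_tendstoUniformlyOn {G : ℕ → E → F} {g : E → F} {x : E}
    (h : TendstoUniformlyOn (fun n => iteratedFDeriv ℝ 1 (G n)) (iteratedFDeriv ℝ 1 g) atTop {x}) :
    Tendsto (fun n => fderiv ℝ (G n) x) atTop (𝓝 (fderiv ℝ g x)) := by
  have h1 : Tendsto (fun n => iteratedFDeriv ℝ 1 (G n) x) atTop (𝓝 (iteratedFDeriv ℝ 1 g x)) :=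
    h.tendsto_at (mem_singleton x)
  have h2 : Tendsto (fun n => ‖iteratedFDeriv ℝ 1 (G n) x - iteratedFDeriv ℝ 1 g x‖) atTop (𝓝 0) :=
    tendsto_iff_norm_sub_tendsto_zero.1 h1
  have h3 : Tendsto (fun n => fderiv ℝ (G n) x - fderiv ℝ g x) atTop (𝓝 0) :=
    squeeze_zero_norm (f := fun n => fderiv ℝ (G n) x - fderiv ℝ g x)
      (fun n => (norm_fderiv_sub_eq_norm_iteratedFDeriv_one_sub (G n) g x).le) h2
  exact tendsto_sub_nhds_zero_iff.1 h3

/-- Pointwise convergence of the SECOND derivatives from uniform convergence of the second iterated derivatives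
on the singleton. [folklore] -/
theorem tendsto_fderiv_fderiv_of_tendstoUniformlyOn {G : ℕ → E → F} {g : E → F} {x : E}
    (h : TendstoUniformlyOn (fun n => iteratedFDeriv ℝ 2 (G n)) (iteratedFDeriv ℝ 2 g) atTop {x}) :
    Tendsto (fun n => fderiv ℝ (fderiv ℝ (G n)) x) atTop (𝓝 (fderiv ℝ (fderiv ℝ g) x)) := by
  have h1 : Tendsto (fun n => iteratedFDeriv ℝ 2 (G n) x) atTop (𝓝 (iteratedFDeriv ℝ 2 g x)) :=
    h.tendsto_at (mem_singleton x)
  have h2 : Tendsto (fun n => ‖iteratedFDeriv ℝ 2 (G n) x - iteratedFDeriv ℝ 2 g x‖) atTop (𝓝 0) :=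
    tendsto_iff_norm_sub_tendsto_zero.1 h1
  have h3 : Tendsto (fun n => fderiv ℝ (fderiv ℝ (G n)) x - fderiv ℝ (fderiv ℝ g) x) atTop (𝓝 0) :=
    squeeze_zero_norm (f := fun n => fderiv ℝ (fderiv ℝ (G n)) x - fderiv ℝ (fderiv ℝ g) x)
      (fun n => (norm_fderiv_fderiv_sub_eq (G n) g x).le) h2
  exact tendsto_sub_nhds_zero_iff.1 h3

/-- A uniform bound on `‖Dᵏ Gₙ(x)‖` passes to a pointwise limit of the `k`-th derivatives. [folklore] -/
theorem norm_iteratedFDeriv_le_of_tendstoUniformlyOn {G : ℕ → E → F} {g : E → F} {x : E} {k : ℕ} {Λ : ℝ}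
    (h : TendstoUniformlyOn (fun n => iteratedFDeriv ℝ k (G n)) (iteratedFDeriv ℝ k g) atTop {x})
    (hb : ∀ n, ‖iteratedFDeriv ℝ k (G n) x‖ ≤ Λ) : ‖iteratedFDeriv ℝ k g x‖ ≤ Λ :=
  le_of_tendsto ((continuous_norm.tendsto _).comp (h.tendsto_at (mem_singleton x)))
    (Eventually.of_forall hb)

end Calculus

/-! ### Divergence and curl along pointwise-convergent derivatives -/

section DivCurl

variable {E : Type*} [NormedAddCommGroup E] [InnerProductSpace ℝ E] [FiniteDimensional ℝ E]

/-- **`div = 0` passes to the limit**: if `D(G n)(x) → D g(x)` for every `x` and every `G n` is divergence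
free, then so is `g`. [folklore] -/
theorem isDivFree_of_tendsto_fderiv {G : ℕ → E → E} {g : E → E}
    (h : ∀ x, Tendsto (fun n => fderiv ℝ (G n) x) atTop (𝓝 (fderiv ℝ g x)))
    (hdiv : ∀ n, VectorCalculus.IsDivFree (G n)) : VectorCalculus.IsDivFree g := by
  intro x
  have ht : Tendsto (fun n => VectorCalculus.divergence (G n) x) atTop (𝓝 (VectorCalculus.divergence g x)) :=
    (Literature.Analysis.ODE.continuous_trace_clm.tendsto _).comp (h x)
  have h0 : (fun n => VectorCalculus.divergence (G n) x) = fun _ => (0 : ℝ) := funext fun n => hdiv n x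
  rw [h0] at ht
  exact tendsto_nhds_unique ht tendsto_const_nhds

end DivCurl

section Curl

/-- `curl` converges pointwise where the derivative does. [folklore] -/
theorem tendsto_curl_of_tendsto_fderiv {G : ℕ → EuclideanSpace ℝ (Fin 3) → EuclideanSpace ℝ (Fin 3)}
    {g : EuclideanSpace ℝ (Fin 3) → EuclideanSpace ℝ (Fin 3)} {x : EuclideanSpace ℝ (Fin 3)}
    (h : Tendsto (fun n => fderiv ℝ (G n) x) atTop (𝓝 (fderiv ℝ g x))) :
    Tendsto (fun n => curl (G n) x) atTop (𝓝 (curl g x)) := by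
  simp only [curl_eq_curlCLM]
  exact (curlCLM.continuous.tendsto _).comp h

/-- `D(curl w)(x) = curlCLM ∘ D(Dw)(x)` for `w ∈ C²`. [folklore] -/
theorem fderiv_curl_eq_comp {w : EuclideanSpace ℝ (Fin 3) → EuclideanSpace ℝ (Fin 3)} (hw : ContDiff ℝ 2 w)
    (x : EuclideanSpace ℝ (Fin 3)) :
    fderiv ℝ (curl w) x = curlCLM.comp (fderiv ℝ (fderiv ℝ w) x) := by
  have hfun : curl w = fun y => curlCLM (fderiv ℝ w y) := funext fun y => curl_eq_curlCLM w y
  have hd : DifferentiableAt ℝ (fderiv ℝ w) x :=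
    ((hw.fderiv_right (m := 1) le_rfl).differentiable one_ne_zero) x
  rw [hfun]
  exact (curlCLM.hasFDerivAt.comp x hd.hasFDerivAt).fderiv

/-- `D curl` converges pointwise where the second derivative does (for `C²` fields). [folklore] -/
theorem tendsto_fderiv_curl_of_tendsto {G : ℕ → EuclideanSpace ℝ (Fin 3) → EuclideanSpace ℝ (Fin 3)}
    {g : EuclideanSpace ℝ (Fin 3) → EuclideanSpace ℝ (Fin 3)} {x : EuclideanSpace ℝ (Fin 3)}
    (hG : ∀ n, ContDiff ℝ 2 (G n)) (hg : ContDiff ℝ 2 g)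
    (h : Tendsto (fun n => fderiv ℝ (fderiv ℝ (G n)) x) atTop (𝓝 (fderiv ℝ (fderiv ℝ g) x))) :
    Tendsto (fun n => fderiv ℝ (curl (G n)) x) atTop (𝓝 (fderiv ℝ (curl g) x)) := by
  rw [fderiv_curl_eq_comp hg x]
  have hfun : (fun n => fderiv ℝ (curl (G n)) x) = fun n => curlCLM.comp (fderiv ℝ (fderiv ℝ (G n)) x) :=
    funext fun n => fderiv_curl_eq_comp (hG n) x
  rw [hfun]
  exact (((ContinuousLinearMap.compL ℝ (EuclideanSpace ℝ (Fin 3)) ((EuclideanSpace ℝ (Fin 3)) →L[ℝ] (EuclideanSpace ℝ (Fin 3)))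
    (EuclideanSpace ℝ (Fin 3))) curlCLM).continuous.tendsto _).comp h

/-- The squared Frobenius norm is a continuous function of the linear map. [folklore] -/
theorem continuous_frobeniusNormSq {E : Type*} [NormedAddCommGroup E] [InnerProductSpace ℝ E] [FiniteDimensional ℝ E]
    {F' : Type*} [NormedAddCommGroup F'] [InnerProductSpace ℝ F'] [FiniteDimensional ℝ F'] :
    Continuous (frobeniusNormSq : (E →L[ℝ] F') → ℝ) := by
  unfold frobeniusNormSq
  refine continuous_finsetSum _ fun i _ => ?_
  exact ((ContinuousLinearMap.apply ℝ F' (stdOrthonormalBasis ℝ E i)).continuous.norm).pow 2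

/-- `|L|²_F ≤ (dim E) · ‖L‖²`. [folklore] -/
theorem frobeniusNormSq_le_card_mul {E : Type*} [NormedAddCommGroup E] [InnerProductSpace ℝ E] [FiniteDimensional ℝ E]
    {F' : Type*} [NormedAddCommGroup F'] [InnerProductSpace ℝ F'] [FiniteDimensional ℝ F'] (L : E →L[ℝ] F') :
    frobeniusNormSq L ≤ (Module.finrank ℝ E : ℝ) * ‖L‖ ^ 2 := by
  unfold frobeniusNormSq
  have h1 : ∀ i, ‖L (stdOrthonormalBasis ℝ E i)‖ ^ 2 ≤ ‖L‖ ^ 2 := by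
    intro i
    have h := L.le_opNorm (stdOrthonormalBasis ℝ E i)
    rw [(stdOrthonormalBasis ℝ E).orthonormal.1 i, mul_one] at h
    exact pow_le_pow_left₀ (norm_nonneg _) h 2
  calc ∑ i, ‖L (stdOrthonormalBasis ℝ E i)‖ ^ 2 ≤ ∑ _i, ‖L‖ ^ 2 := Finset.sum_le_sum fun i _ => h1 i
    _ = (Module.finrank ℝ E : ℝ) * ‖L‖ ^ 2 := by
        rw [Finset.sum_const, Finset.card_univ, nsmul_eq_mul, Fintype.card_fin]

/-- `0 ≤ |L|²_F`. [folklore] -/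
theorem frobeniusNormSq_nonneg' {E : Type*} [NormedAddCommGroup E] [InnerProductSpace ℝ E] [FiniteDimensional ℝ E]
    {F' : Type*} [NormedAddCommGroup F'] [InnerProductSpace ℝ F'] [FiniteDimensional ℝ F'] (L : E →L[ℝ] F') :
    0 ≤ frobeniusNormSq L := by
  unfold frobeniusNormSq
  exact Finset.sum_nonneg fun i _ => sq_nonneg _

end Curl

/-! ### Dominated convergence on a bounded set with a uniform constant bound -/

section Integral

variable {E : Type*} [MeasurableSpace E] {μ : Measure E}

/-- **Exactness on bounded sets.** If continuous real functions `F n → F∞` pointwise and `|F n| ≤ C` uniformly, then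
`∫_D F n → ∫_D F∞` for every measurable `D` of finite measure. [folklore] -/
theorem tendsto_setIntegral_of_bounded_tendsto {F : ℕ → E → ℝ} {Finf : E → ℝ} {D : Set E} {C : ℝ}
    (hD : μ D ≠ ⊤) (hFm : ∀ n, AEStronglyMeasurable (F n) (μ.restrict D))
    (hb : ∀ n x, |F n x| ≤ C) (hlim : ∀ x, Tendsto (fun n => F n x) atTop (𝓝 (Finf x))) :
    Tendsto (fun n => ∫ x in D, F n x ∂μ) atTop (𝓝 (∫ x in D, Finf x ∂μ)) := by
  haveI : IsFiniteMeasure (μ.restrict D) := ⟨by rwa [Measure.restrict_apply_univ, lt_top_iff_ne_top]⟩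
  refine tendsto_integral_of_dominated_convergence (fun _ => C) hFm (integrable_const C) ?_ ?_
  · exact fun n => Eventually.of_forall fun x => by rw [Real.norm_eq_abs]; exact hb n x
  · exact Eventually.of_forall hlim

end Integral

/-! ### The translate-compactness theorem -/

section Compactness

variable {E : Type*} [NormedAddCommGroup E] [NormedSpace ℝ E] [FiniteDimensional ℝ E]
  {F : Type*} [NormedAddCommGroup F] [NormedSpace ℝ F] [FiniteDimensional ℝ F]

omit [FiniteDimensional ℝ E] [FiniteDimensional ℝ F] in
/-- Iterated derivatives of a translate. [folklore] -/
theorem iteratedFDeriv_translate (w : E → F) (a : E) (k : ℕ) (z : E) :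
    iteratedFDeriv ℝ k (fun z => w (a + z)) z = iteratedFDeriv ℝ k w (a + z) := by
  have h := iteratedFDeriv_comp_add_right (𝕜 := ℝ) (f := w) k a z
  -- `fun y => w (y + a)` vs `fun z => w (a + z)`
  have hfun : (fun z => w (a + z)) = fun y => w (y + a) := funext fun y => by rw [add_comm]
  rw [hfun, h, add_comm]

/-- **Translate-compactness with uniform `Cᵏ` bounds.** Let `v n : E → F` be smooth with `‖Dᵏ(v n)(x)‖ ≤ Λ k` for all
`k, n, x`, and let `y n` be any centres. Then a subsequence of the translates `z ↦ v (φ n) (y (φ n) + z)` converges,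
with all derivatives and uniformly on compact sets, to a smooth `W₀` obeying the same bounds; in particular it
converges pointwise. [cite: Petersen2006, Ch. 10 §3.1] -/
theorem exists_translate_limit (v : ℕ → E → F) (Λ : ℕ → ℝ) (hv : ∀ n, ContDiff ℝ ∞ (v n))
    (hb : ∀ (k : ℕ) n x, ‖iteratedFDeriv ℝ k (v n) x‖ ≤ Λ k) (y : ℕ → E) :
    ∃ (φ : ℕ → ℕ) (W₀ : E → F), StrictMono φ ∧ ContDiff ℝ ∞ W₀ ∧
      (∀ k x, ‖iteratedFDeriv ℝ k W₀ x‖ ≤ Λ k) ∧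
      (∀ (i : ℕ) (K : Set E), IsCompact K →
        TendstoUniformlyOn (fun n => iteratedFDeriv ℝ i (fun z => v (φ n) (y (φ n) + z)))
          (iteratedFDeriv ℝ i W₀) atTop K) ∧
      (∀ z, Tendsto (fun n => v (φ n) (y (φ n) + z)) atTop (𝓝 (W₀ z))) := by
  -- the translates and their bounds
  set f : ℕ → E → F := fun n z => v n (y n + z) with hf
  have hfs : ∀ n, ContDiffOn ℝ ∞ (f n) univ := fun n =>
    ((hv n).comp (contDiff_const.add contDiff_id)).contDiffOn
  have hfb : ∀ (i : ℕ), ∀ K ⊆ (univ : Set E), IsCompact K →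
      ∃ Λ' : ℝ, ∀ n, ∀ z ∈ K, ‖iteratedFDeriv ℝ i (f n) z‖ ≤ Λ' := by
    intro i K _ _
    refine ⟨Λ i, fun n z _ => ?_⟩
    rw [hf, iteratedFDeriv_translate (v n) (y n) i z]
    exact hb i n _
  obtain ⟨g, φ, hφ, hg, hlim⟩ :=
    exists_strictMono_contDiffOn_infty_tendstoUniformlyOn_iteratedFDeriv isOpen_univ hfs hfb
  have hg' : ContDiff ℝ ∞ g := contDiffOn_univ.1 hg
  have hlim' : ∀ (i : ℕ) (K : Set E), IsCompact K →
      TendstoUniformlyOn (fun n => iteratedFDeriv ℝ i (f (φ n))) (iteratedFDeriv ℝ i g) atTop K :=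
    fun i K hK => hlim i K (subset_univ K) hK
  refine ⟨φ, g, hφ, hg', ?_, ?_, ?_⟩
  · intro k x
    refine norm_iteratedFDeriv_le_of_tendstoUniformlyOn (hlim' k {x} isCompact_singleton) fun n => ?_
    rw [hf, iteratedFDeriv_translate (v (φ n)) (y (φ n)) k x]
    exact hb k (φ n) _
  · intro i K hK
    exact hlim' i K hK
  · intro z
    exact tendsto_of_tendstoUniformlyOn_zero (hlim' 0 {z} isCompact_singleton)

omit [NormedAddCommGroup E] [NormedSpace ℝ E] [FiniteDimensional ℝ E] [NormedSpace ℝ F] [FiniteDimensional ℝ F] in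
/-- A uniform height bound passes to the pointwise limit. [folklore] -/
theorem norm_le_of_tendsto {G : ℕ → E → F} {g : E → F} {M : ℝ} (hM : ∀ n x, ‖G n x‖ ≤ M)
    (h : ∀ z, Tendsto (fun n => G n z) atTop (𝓝 (g z))) (x : E) : ‖g x‖ ≤ M :=
  le_of_tendsto ((continuous_norm.tendsto _).comp (h x)) (Eventually.of_forall fun n => hM n x)

end Compactness

/-! ### The package for a near-extremal family (texts of record `NearExtremalFamily`) -/

section Package

/-- **The limit step of T1 `CoherentSelection`, for ANY centres.** For a near-extremal family `v` (texts of record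
`NearExtremalFamily v Λ Θ ε`: smooth, divergence free, `‖v n‖ ≤ 1`, `‖Dᵏ v n‖ ≤ Λ k`) and any centres `y n` there are
a subsequence `φ` and a smooth divergence-free `W₀` with `‖W₀‖ ≤ 1`, `‖Dᵏ W₀‖ ≤ Λ k`, such that the translates
`z ↦ v (φ n) (y (φ n) + z)` converge to `W₀` pointwise and in `C^∞_loc`, their `curl`, `D`, `D curl` converge
pointwise, and — EXACTNESS — for every bounded measurable `D` the restricted enstrophy `∫_D ‖curl‖²`, palinstrophy
`∫_D |D curl|²_F` and stretching `∫_D ⟪curl, D· curl⟫` of the translates converge to those of `W₀`. [folklore] -/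
theorem exists_limit_of_nearExtremalFamily {v : ℕ → EuclideanSpace ℝ (Fin 3) → EuclideanSpace ℝ (Fin 3)}
    {Λ : ℕ → ℝ} {Θ : ℝ} {ε : ℕ → ℝ} (hv : NearExtremalFamily v Λ Θ ε)
    (y : ℕ → EuclideanSpace ℝ (Fin 3)) :
    ∃ (φ : ℕ → ℕ) (W₀ : EuclideanSpace ℝ (Fin 3) → EuclideanSpace ℝ (Fin 3)), StrictMono φ ∧
      ContDiff ℝ ∞ W₀ ∧ Literature.Analysis.FluidPDE.VectorCalculus.IsDivFree W₀ ∧ (∀ x, ‖W₀ x‖ ≤ 1) ∧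
      (∀ k x, ‖iteratedFDeriv ℝ k W₀ x‖ ≤ Λ k) ∧
      (∀ z, Tendsto (fun n => v (φ n) (y (φ n) + z)) atTop (𝓝 (W₀ z))) ∧
      (∀ (i : ℕ) (K : Set (EuclideanSpace ℝ (Fin 3))), IsCompact K →
        TendstoUniformlyOn (fun n => iteratedFDeriv ℝ i (fun z => v (φ n) (y (φ n) + z)))
          (iteratedFDeriv ℝ i W₀) atTop K) ∧
      (∀ z, Tendsto (fun n => curl (fun z => v (φ n) (y (φ n) + z)) z) atTop (𝓝 (curl W₀ z))) ∧
      (∀ z, Tendsto (fun n => fderiv ℝ (fun z => v (φ n) (y (φ n) + z)) z) atTop (𝓝 (fderiv ℝ W₀ z))) ∧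
      (∀ z, Tendsto (fun n => fderiv ℝ (curl (fun z => v (φ n) (y (φ n) + z))) z) atTop
        (𝓝 (fderiv ℝ (curl W₀) z))) ∧
      (∀ D : Set (EuclideanSpace ℝ (Fin 3)), MeasurableSet D → Bornology.IsBounded D →
        Tendsto (fun n => ∫ x in D, ‖curl (fun z => v (φ n) (y (φ n) + z)) x‖ ^ 2) atTop
          (𝓝 (∫ x in D, ‖curl W₀ x‖ ^ 2)) ∧
        Tendsto (fun n => ∫ x in D, frobeniusNormSq (fderiv ℝ (curl (fun z => v (φ n) (y (φ n) + z))) x)) atTop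
          (𝓝 (∫ x in D, frobeniusNormSq (fderiv ℝ (curl W₀) x))) ∧
        Tendsto (fun n => ∫ x in D, ⟪curl (fun z => v (φ n) (y (φ n) + z)) x,
            fderiv ℝ (fun z => v (φ n) (y (φ n) + z)) x (curl (fun z => v (φ n) (y (φ n) + z)) x)⟫_ℝ) atTop
          (𝓝 (∫ x in D, ⟪curl W₀ x, fderiv ℝ W₀ x (curl W₀ x)⟫_ℝ))) := by
  obtain ⟨hsm, hdiv, hone, hbd, -⟩ := hv
  obtain ⟨φ, W₀, hφ, hW, hWb, hunif, hpt⟩ := exists_translate_limit v Λ hsm hbd y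
  -- the translates along the subsequence
  set f : ℕ → EuclideanSpace ℝ (Fin 3) → EuclideanSpace ℝ (Fin 3) := fun n z => v (φ n) (y (φ n) + z) with hfdef
  have hfs : ∀ n, ContDiff ℝ ∞ (f n) := fun n => (hsm (φ n)).comp (contDiff_const.add contDiff_id)
  have hf1 : ∀ n, ContDiff ℝ 1 (f n) := fun n => contDiff_infty.1 (hfs n) 1
  have hf2 : ∀ n, ContDiff ℝ 2 (f n) := fun n => contDiff_infty.1 (hfs n) 2
  have hW2 : ContDiff ℝ 2 W₀ := contDiff_infty.1 hW 2
  -- pointwise convergence of `D` and `D²`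
  have hD : ∀ z, Tendsto (fun n => fderiv ℝ (f n) z) atTop (𝓝 (fderiv ℝ W₀ z)) := fun z =>
    tendsto_fderiv_of_tendstoUniformlyOn (hunif 1 {z} isCompact_singleton)
  have hD2 : ∀ z, Tendsto (fun n => fderiv ℝ (fderiv ℝ (f n)) z) atTop (𝓝 (fderiv ℝ (fderiv ℝ W₀) z)) := fun z =>
    tendsto_fderiv_fderiv_of_tendstoUniformlyOn (hunif 2 {z} isCompact_singleton)
  have hcurl : ∀ z, Tendsto (fun n => curl (f n) z) atTop (𝓝 (curl W₀ z)) := fun z =>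
    tendsto_curl_of_tendsto_fderiv (hD z)
  have hDcurl : ∀ z, Tendsto (fun n => fderiv ℝ (curl (f n)) z) atTop (𝓝 (fderiv ℝ (curl W₀) z)) := fun z =>
    tendsto_fderiv_curl_of_tendsto hf2 hW2 (hD2 z)
  -- divergence free in the limit (each translate is divergence free)
  have hfdiv : ∀ n, Literature.Analysis.FluidPDE.VectorCalculus.IsDivFree (f n) := by
    intro n z
    have h1 : fderiv ℝ (f n) z = fderiv ℝ (v (φ n)) (y (φ n) + z) := by
      have hfun : f n = fun z => v (φ n) (z + y (φ n)) := funext fun z => by rw [hfdef]; simp [add_comm]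
      rw [hfun, fderiv_comp_add_right, add_comm]
    unfold Literature.Analysis.FluidPDE.VectorCalculus.divergence
    rw [h1]
    exact hdiv (φ n) (y (φ n) + z)
  have hWdiv : Literature.Analysis.FluidPDE.VectorCalculus.IsDivFree W₀ := isDivFree_of_tendsto_fderiv hD hfdiv
  -- uniform bounds on `D f n`, `curl f n`, `D curl f n`
  have hDb : ∀ n x, ‖fderiv ℝ (f n) x‖ ≤ Λ 1 := by
    intro n x
    rw [norm_fderiv_eq_norm_iteratedFDeriv_one, hfdef, iteratedFDeriv_translate (v (φ n)) (y (φ n)) 1 x]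
    exact hbd 1 (φ n) _
  have hcb : ∀ n x, ‖curl (f n) x‖ ≤ ‖curlCLM‖ * Λ 1 := fun n x =>
    (norm_curl_le (f n) x).trans (mul_le_mul_of_nonneg_left (hDb n x) (ContinuousLinearMap.opNorm_nonneg _))
  have hD2b : ∀ n x, ‖fderiv ℝ (fderiv ℝ (f n)) x‖ ≤ Λ 2 := by
    intro n x
    rw [norm_fderiv_eq_norm_iteratedFDeriv_one, norm_iteratedFDeriv_fderiv, hfdef,
      iteratedFDeriv_translate (v (φ n)) (y (φ n)) 2 x]
    exact hbd 2 (φ n) _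
  have hDcb : ∀ n x, ‖fderiv ℝ (curl (f n)) x‖ ≤ ‖curlCLM‖ * Λ 2 := by
    intro n x
    rw [fderiv_curl_eq_comp (hf2 n) x]
    exact (ContinuousLinearMap.opNorm_comp_le _ _).trans
      (mul_le_mul_of_nonneg_left (hD2b n x) (ContinuousLinearMap.opNorm_nonneg _))
  -- measurability of the three densities (continuity)
  have hcont_curl : ∀ n, Continuous (curl (f n)) := fun n =>
    (contDiff_curl (n := 0) (by exact_mod_cast hf1 n)).continuous
  have hcont_D : ∀ n, Continuous (fderiv ℝ (f n)) := fun n => (hf1 n).continuous_fderiv one_ne_zero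
  have hcont_Dcurl : ∀ n, Continuous (fderiv ℝ (curl (f n))) := fun n =>
    (contDiff_curl (n := 1) (by exact_mod_cast hf2 n)).continuous_fderiv one_ne_zero
  refine ⟨φ, W₀, hφ, hW, hWdiv, fun x => norm_le_of_tendsto (fun n x => hone (φ n) (y (φ n) + x)) hpt x, hWb, hpt,
    hunif, hcurl, hD, hDcurl, fun D hDm hDb' => ⟨?_, ?_, ?_⟩⟩
  · -- enstrophy density `‖curl‖²`, bound `(‖curlCLM‖ Λ 1)²`
    refine tendsto_setIntegral_of_bounded_tendsto (C := (‖curlCLM‖ * Λ 1) ^ 2) hDb'.measure_lt_top.ne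
      (fun n => ((hcont_curl n).norm.pow 2).aestronglyMeasurable) (fun n x => ?_) (fun x => ?_)
    · rw [abs_of_nonneg (sq_nonneg _)]
      exact pow_le_pow_left₀ (norm_nonneg _) (hcb n x) 2
    · exact ((continuous_norm.pow 2).tendsto _).comp (hcurl x)
  · -- palinstrophy density `|D curl|²_F`, bound `3 (‖curlCLM‖ Λ 2)²`
    refine tendsto_setIntegral_of_bounded_tendsto (C := 3 * (‖curlCLM‖ * Λ 2) ^ 2) hDb'.measure_lt_top.ne
      (fun n => (continuous_frobeniusNormSq.comp (hcont_Dcurl n)).aestronglyMeasurable) (fun n x => ?_) (fun x => ?_)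
    · rw [abs_of_nonneg (frobeniusNormSq_nonneg' _)]
      calc frobeniusNormSq (fderiv ℝ (curl (f n)) x)
          ≤ (Module.finrank ℝ (EuclideanSpace ℝ (Fin 3)) : ℝ) * ‖fderiv ℝ (curl (f n)) x‖ ^ 2 :=
            frobeniusNormSq_le_card_mul _
        _ = 3 * ‖fderiv ℝ (curl (f n)) x‖ ^ 2 := by rw [finrank_euclideanSpace_fin]; norm_num
        _ ≤ 3 * (‖curlCLM‖ * Λ 2) ^ 2 := by
            have := hDcb n x
            gcongr
    · exact (continuous_frobeniusNormSq.tendsto _).comp (hDcurl x)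
  · -- stretching density `⟪curl, D· curl⟫`, bound `(‖curlCLM‖ Λ 1)² Λ 1`
    refine tendsto_setIntegral_of_bounded_tendsto (C := (‖curlCLM‖ * Λ 1) ^ 2 * Λ 1) hDb'.measure_lt_top.ne
      (fun n => ?_) (fun n x => ?_) (fun x => ?_)
    · exact ((hcont_curl n).inner ((hcont_D n).clm_apply (hcont_curl n))).aestronglyMeasurable
    · calc |⟪curl (f n) x, fderiv ℝ (f n) x (curl (f n) x)⟫_ℝ|
          ≤ ‖curl (f n) x‖ * ‖fderiv ℝ (f n) x (curl (f n) x)‖ := abs_real_inner_le_norm _ _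
        _ ≤ ‖curl (f n) x‖ * (‖fderiv ℝ (f n) x‖ * ‖curl (f n) x‖) :=
            mul_le_mul_of_nonneg_left (ContinuousLinearMap.le_opNorm _ _) (norm_nonneg _)
        _ = ‖curl (f n) x‖ ^ 2 * ‖fderiv ℝ (f n) x‖ := by ring
        _ ≤ (‖curlCLM‖ * Λ 1) ^ 2 * Λ 1 := by
            have h1 := hcb n x
            have h2 := hDb n x
            have h0 : 0 ≤ ‖curlCLM‖ * Λ 1 := (norm_nonneg _).trans h1
            gcongr
    · have happ : Tendsto (fun n => fderiv ℝ (f n) x (curl (f n) x)) atTop (𝓝 (fderiv ℝ W₀ x (curl W₀ x))) :=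
        ((isBoundedBilinearMap_apply (𝕜 := ℝ) (E := EuclideanSpace ℝ (Fin 3))
          (F := EuclideanSpace ℝ (Fin 3))).continuous.tendsto (fderiv ℝ W₀ x, curl W₀ x)).comp
          ((hD x).prodMk_nhds (hcurl x))
      exact (hcurl x).inner happ

end Package

end Summit.NavierStokesRegularity.NavierStokesRegularity.Theorems.NearExtremalTransiencePerFlow.MemberSelection
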